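import Summits.ValiantsHypothesis.ValiantsHypothesis.Theorems.BarrierLeverChowHitsThinRowPartitionMinorsRLabels

/-!
# Route BarrierLever — item `ChowHitsThinRowPartitionMinorsR` (stmt-ValiantsHypothesis-21850, budget
# `h·h`): UNCONDITIONAL SLICES — every thin layout with few incidences is hit, at every height

Helper file (`--supports stmt-ValiantsHypothesis-21850`; cell valiant-natproofs, rung V4, 𝒟-side;
seat val-np-p5 gen 28).  Closes NO item; definition-free; imports this seat's `…RLabels`
(labelled certificate) and, through it, val-np-p7 g4's `exists_downClosed_monomialBasis`.

* `chowHitsHH_of_card` — rows `u` injective of size `≤ 2`, columns `w` injective, any `h`: if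
  `#singleton rows + h + 2·#pair rows ≤ h·h` then some product of `h·h` affine forms has a nonsingular
  partition minor on `(u, w)` (item 21850's conclusion for the layout).  Proof: a down-closed monomial
  basis of the columns, relabelled so that the empty row carries `∅`, feeds `chowHitsHH_of_labels`.
* `chowHitsHH_of_few_pairs` — the same whenever `2·#pair rows + 2h ≤ h·h`; in particular every thin
  layout with at most `C(h,2) − h` pair rows (any singleton rows, any distinct columns) is hit.

So item 21850 is reduced to the layouts with MORE than `h·h − h` row incidences
(`#singles + 2·#pairs`), i.e. those missing fewer than `h` incidences from the full thin family; by
`chowHitsHH_of_labels` such a layout is still hit unless its column family has positive affine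
defect (fewer than `|∪ w j|` affinely independent coordinates on the column points).

WHAT THIS IS NOT: item 21850 is NOT proved; nothing on items 21882 / 19717, on crux
stmt-ValiantsHypothesis-14610, or on `VP` versus `VNP`.
-/

set_option linter.dupNamespace false

namespace Summit.ValiantsHypothesis.ValiantsHypothesis.Theorems.BarrierLever.ChowThinHH

open Finset MvPolynomial

/-! ## Unconditional slices: few incidences -/

/-- **Every thin layout with `#singleton rows + h + 2·#pair rows ≤ h·h` is hit by `h·h` affine
forms, at every height** (rows `u` injective of size `≤ 2`, columns `w` injective, otherwise
arbitrary).  The down-closed monomial basis comes from `ChowThinAll.exists_downClosed_monomialBasis`,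
relabelled so that the empty row (if any) carries the label `∅`. -/
theorem chowHitsHH_of_card (h r : ℕ) (u w : Fin r → Finset (Fin h))
    (hu : Function.Injective u) (hw : Function.Injective w) (hu2 : ∀ i, (u i).card ≤ 2)
    (hbudget : (Finset.univ.filter fun i : Fin r => (u i).card = 1).card + h +
      2 * (Finset.univ.filter fun i : Fin r => (u i).card = 2).card ≤ h * h) :
    ∃ ℓ : Fin (h * h) → MvPolynomial (Fin (h + h)) ℂ, (∀ k, (ℓ k).totalDegree ≤ 1) ∧
      (Matrix.of fun i j : Fin r => MvPolynomial.coeff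
        (∑ a ∈ u i, Finsupp.single (Fin.castAdd h a) 1 +
          ∑ c ∈ w j, Finsupp.single (Fin.natAdd h c) 1) (∏ k, ℓ k)).det ≠ 0 := by
  classical
  obtain ⟨U₀, hU₀inj, hU₀down, hZ₀⟩ := ChowThinAll.exists_downClosed_monomialBasis w hw
  -- relabel so that the empty row carries `∅`
  obtain ⟨σ, hσ⟩ : ∃ σ : Equiv.Perm (Fin r), ∀ i, u i = ∅ → U₀ (σ i) = ∅ := by
    by_cases hz : ∃ i, u i = ∅
    · obtain ⟨iz, hiz⟩ := hz
      obtain ⟨i₀, hi₀⟩ := hU₀down iz ∅ (Finset.empty_subset _)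
      refine ⟨Equiv.swap iz i₀, fun i hi => ?_⟩
      have e : i = iz := hu (hi.trans hiz.symm)
      subst e
      rw [Equiv.swap_apply_left, hi₀]
    · exact ⟨Equiv.refl _, fun i hi => absurd ⟨i, hi⟩ hz⟩
  set U : Fin r → Finset (Fin h) := fun i => U₀ (σ i) with hU
  have hUinj : Function.Injective U := hU₀inj.comp σ.injective
  have hUdown : ∀ i (S : Finset (Fin h)), S ⊆ U i → ∃ i', U i' = S := by
    intro i S hS
    obtain ⟨i', hi'⟩ := hU₀down (σ i) S hS
    exact ⟨σ.symm i', by simp only [hU, Equiv.apply_symm_apply, hi']⟩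
  have hZ : (Matrix.of fun i j : Fin r => if U i ⊆ w j then (1 : ℂ) else 0).det ≠ 0 := by
    have e : (Matrix.of fun i j : Fin r => if U i ⊆ w j then (1 : ℂ) else 0) =
        (Matrix.of fun i j : Fin r => if U₀ i ⊆ w j then (1 : ℂ) else 0).submatrix σ id := by
      ext i j
      rfl
    rw [e, Matrix.det_permute]
    refine mul_ne_zero ?_ hZ₀
    rcases Int.units_eq_one_or (Equiv.Perm.sign σ) with h1 | h1 <;> simp [h1]
  refine chowHitsHH_of_labels h r u w hu hu2 U hUinj hUdown (fun i hi => hσ i hi) hZ ?_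
  refine le_trans ?_ hbudget
  refine Nat.add_le_add_right ((Finset.card_union_le _ _).trans (Nat.add_le_add ?_ ?_)) _
  · exact Finset.card_image_le
  · exact Finset.card_image_le.trans (by rw [Finset.card_univ, Fintype.card_fin])

/-- **Few pair rows**: every thin layout with `2·#pair rows + 2h ≤ h·h` — e.g. at most
`C(h,2) − h` pair rows, any singleton rows, any (distinct) columns — is hit by `h·h` affine forms, at
every height `h`. -/
theorem chowHitsHH_of_few_pairs (h r : ℕ) (u w : Fin r → Finset (Fin h))
    (hu : Function.Injective u) (hw : Function.Injective w) (hu2 : ∀ i, (u i).card ≤ 2)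
    (hpairs : 2 * (Finset.univ.filter fun i : Fin r => (u i).card = 2).card + 2 * h ≤ h * h) :
    ∃ ℓ : Fin (h * h) → MvPolynomial (Fin (h + h)) ℂ, (∀ k, (ℓ k).totalDegree ≤ 1) ∧
      (Matrix.of fun i j : Fin r => MvPolynomial.coeff
        (∑ a ∈ u i, Finsupp.single (Fin.castAdd h a) 1 +
          ∑ c ∈ w j, Finsupp.single (Fin.natAdd h c) 1) (∏ k, ℓ k)).det ≠ 0 := by
  classical
  refine chowHitsHH_of_card h r u w hu hw hu2 (le_trans ?_ hpairs)
  -- `#singleton rows ≤ h`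
  have hS : (Finset.univ.filter fun i : Fin r => (u i).card = 1).card ≤ h := by
    rw [← Finset.card_image_of_injective _ hu]
    refine (Finset.card_le_card ?_).trans
      (Finset.card_image_le.trans (by rw [Finset.card_univ, Fintype.card_fin]) :
        (Finset.univ.image fun c : Fin h => ({c} : Finset (Fin h))).card ≤ h)
    intro S hS
    obtain ⟨i, hi, rfl⟩ := Finset.mem_image.mp hS
    obtain ⟨c, hc⟩ := Finset.card_eq_one.mp (Finset.mem_filter.mp hi).2
    exact Finset.mem_image.mpr ⟨c, Finset.mem_univ _, hc.symm⟩
  omega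
end Summit.ValiantsHypothesis.ValiantsHypothesis.Theorems.BarrierLever.ChowThinHH
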